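import Mathlib.MeasureTheory.Integral.DominatedConvergence
import Mathlib.MeasureTheory.Integral.IntegralEqImproper
import Mathlib.Analysis.SpecialFunctions.Trigonometric.Basic
import Literature.NumberTheory.LFunctions.WeilExplicit
import HarnessLib

/-!
# Connes–Consani 2021, Prop. 2.2 (iii): the cosine-tail transform `cosTail` (shared DEFINITIONS + API)

A. Connes, C. Consani, *Weil positivity and trace formula, the archimedean place*, Selecta Math.
(N.S.) 27 (2021) 77 = arXiv:2006.13771 [bib: `ConnesConsani2021`], §1–§2.  The discharge of the named
fact `CC2021_prop_2_2_iii` ("`Tr(ϑ(f)PP̂P) = L(f)`", `SchwartzKernels.lean`) runs, after the cell's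
reductions (`CutoffScalingKernelTrace.lean`: the Hilbert–Schmidt socket; `CutoffScalingKernel.lean`: the
`L²` kernel `k_g` of `P𝓕Pϑ(g)E`), through ONE scalar object: the column of `k_g` in logarithmic
coordinates.  With `(ξ, y) ↦ (s, c) = (log|ξ|, log|ξ| + log|y|)` the kernel column is
`(|ξ||y|)^{-1/2}·cosTail g s c`, where

* `cosTail g s c := ∫_{v ≥ s} g(v − c) e^{v/2} cos(2π e^v) dv` — the TAIL (`v ≥ s`) of the cosine
  transform of `x^{-1/2} g(log x)` written in the variable `v = log(xξ)`; the cut `v ≥ s` is the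
  projection `P = 1_{[1,∞)}` of §1 eq. (17) seen from the frequency `ξ = e^s`;
* `cosTailFull g c := ∫_ℝ g(v − c) e^{v/2} cos(2π e^v) dv` — the same integral without the cut
  (`= cosTail g s c` as soon as `s ≤ c − a`, `supp g ⊆ [−a, a]`): with `w = e^c` it is
  `w^{1/2}·∫₀^∞ x^{-1/2} g(log x) cos(2πwx) dx`, i.e. `½ w^{1/2}·𝓕(|x|^{-1/2}g(log|x|))(w)`, the function
  whose Mellin multiplier on the critical line is `u_∞ = e^{2iθ}` (Lemma 1.3 = `CC2021_lemma_6`).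

The Hilbert–Schmidt identity behind Prop. 2.2 (iii) then reads
`4 ∫_{s ≥ 0} ∫_ℝ ‖cosTail g s c‖² dc ds = Re L(g ∗ g*)` (cell board 2026-08-26, gm-t15 08:17:30Z), proved
in companion files (the `W_∞` half through `θ′`, i.e. `Γ′/Γ`-terms, and the square-`Δ` half through
the DISCHARGED Prop. 2.2 (i)).  This file only fixes the two definitions and their elementary API
(support cut-offs, bounds, continuity, integrability), so that the operator side and the two analytic
halves import ONE definition.  Theorems + definitions with bodies; no named facts.

Label: RH-FREE archimedean analysis; bears_on W-C/W-P (K1 boundary fact `CC2021_prop_2_2_iii`);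
nothing here bears on the truth of RH.

## References
* A. Connes, C. Consani, arXiv:2006.13771, §1 Lemma 1.3–1.4 (arXiv items 6–7), eq. (16)–(17) p. 7;
  §2 Prop. 2.2 (iii) (= arXiv Prop. 10 (iii)) p. 10. [ConnesConsani2021]
-/

noncomputable section

open _root_.MeasureTheory Complex Set Filter
open scoped Real Topology

namespace Literature.NumberTheory.ConnesConsani2021

open Literature.NumberTheory.LFunctions

variable {g : ℝ → ℂ} {a s c : ℝ}

/-! ## The kernel `e^{v/2} cos(2π e^v)` and the two transforms -/

/-- The cosine kernel of Lemma 1.4 (i) (`k^u(λ, μ) = 2λ^{-1/2}μ^{1/2}cos(2πμ/λ)`, eq. (16)) in the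
logarithmic variable `v = log(μ/λ)`, up to the factor `2`: `K(v) := e^{v/2} cos(2π e^v)`.
[cite: ConnesConsani2021, §1 Lemma 1.4 (i) (arXiv: Lemma 7 (i)) eq. (16) p. 7] -/
def cosTailKernel (v : ℝ) : ℝ :=
  Real.exp (v / 2) * Real.cos (2 * π * Real.exp v)

/-- **The cosine-tail transform** `cosTail g s c := ∫_{v ≥ s} g(v − c) e^{v/2} cos(2π e^v) dv`: the
column, in logarithmic coordinates `(s, c) = (log|ξ|, log|ξ| + log|y|)`, of the `L²` kernel of
`P𝓕Pϑ(g)E` (the cut `v ≥ s` is the projection `P`, §1 eq. (17); the kernel is `k^u` of Lemma 1.4 (i)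
composed with the kernel `g(log(x/y))(xy)^{-1/2}` of `ϑ(g)`).  Body fixed by the cell (gm-t15,
2026-08-26). [cite: ConnesConsani2021, §2 Prop. 2.2 (iii) (= arXiv Prop. 10 (iii)) p. 10; §1 eq. (16)–(17) p. 7] -/
def cosTail (g : ℝ → ℂ) (s c : ℝ) : ℂ :=
  ∫ v in Set.Ici s, g (v - c) * ((Real.exp (v / 2) * Real.cos (2 * π * Real.exp v) : ℝ) : ℂ)

/-- **The full cosine transform in logarithmic variables** `cosTailFull g c := ∫_ℝ g(v − c) e^{v/2}
cos(2π e^v) dv` (no cut).  With `w = e^c`: `cosTailFull g c = w^{1/2} ∫₀^∞ x^{-1/2} g(log x) cos(2πwx) dx`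
(substitute `x = e^{v−c}`), the cosine transform whose Mellin multiplier is `u_∞` (Lemma 1.3).
[cite: ConnesConsani2021, §1 Lemma 1.3–1.4 (arXiv: Lemmas 6–7) p. 7] -/
def cosTailFull (g : ℝ → ℂ) (c : ℝ) : ℂ :=
  ∫ v : ℝ, g (v - c) * ((Real.exp (v / 2) * Real.cos (2 * π * Real.exp v) : ℝ) : ℂ)

/-- `cosTail` written with the named kernel. [cite: ConnesConsani2021, §1 eq. (16) p. 7] -/
theorem cosTail_eq (g : ℝ → ℂ) (s c : ℝ) :
    cosTail g s c = ∫ v in Set.Ici s, g (v - c) * (cosTailKernel v : ℂ) := rfl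

/-- `cosTailFull` written with the named kernel. [cite: ConnesConsani2021, §1 eq. (16) p. 7] -/
theorem cosTailFull_eq (g : ℝ → ℂ) (c : ℝ) :
    cosTailFull g c = ∫ v : ℝ, g (v - c) * (cosTailKernel v : ℂ) := rfl

/-- The kernel is continuous. [cite: ConnesConsani2021, §2 Prop. 2.2 (iii) (= arXiv Prop. 10 (iii)) p. 10; §1 eq. (16)–(17) p. 7] -/
theorem continuous_cosTailKernel : Continuous cosTailKernel := by
  unfold cosTailKernel; fun_prop

/-- `|K(v)| ≤ e^{v/2}`. [cite: ConnesConsani2021, §2 Prop. 2.2 (iii) (= arXiv Prop. 10 (iii)) p. 10; §1 eq. (16)–(17) p. 7] -/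
theorem abs_cosTailKernel_le (v : ℝ) : |cosTailKernel v| ≤ Real.exp (v / 2) := by
  rw [cosTailKernel, abs_mul, abs_of_pos (Real.exp_pos _)]
  exact mul_le_of_le_one_right (Real.exp_pos _).le (Real.abs_cos_le_one _)

/-- `‖(K(v) : ℂ)‖ ≤ e^{v/2}`. [cite: ConnesConsani2021, §2 Prop. 2.2 (iii) (= arXiv Prop. 10 (iii)) p. 10; §1 eq. (16)–(17) p. 7] -/
theorem norm_cosTailKernel_le (v : ℝ) : ‖(cosTailKernel v : ℂ)‖ ≤ Real.exp (v / 2) := by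
  rw [Complex.norm_real, Real.norm_eq_abs]; exact abs_cosTailKernel_le v

/-- `cosTail` as an integral over `ℝ` of an indicator. [cite: ConnesConsani2021, §2 Prop. 2.2 (iii) (= arXiv Prop. 10 (iii)) p. 10; §1 eq. (16)–(17) p. 7] -/
theorem cosTail_eq_integral_indicator (g : ℝ → ℂ) (s c : ℝ) :
    cosTail g s c = ∫ v : ℝ, (Set.Ici s).indicator (fun v => g (v - c) * (cosTailKernel v : ℂ)) v := by
  rw [cosTail_eq, integral_indicator measurableSet_Ici]

/-- `cosTailFull` after the substitution `v = u + c`: `∫ g(u) K(u + c) du` (a correlation of `g` with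
the kernel). [cite: ConnesConsani2021, §2 Prop. 2.2 (iii) (= arXiv Prop. 10 (iii)) p. 10; §1 eq. (16)–(17) p. 7] -/
theorem cosTailFull_eq_integral_comp_add (g : ℝ → ℂ) (c : ℝ) :
    cosTailFull g c = ∫ u : ℝ, g u * (cosTailKernel (u + c) : ℂ) := by
  rw [cosTailFull_eq, ← integral_add_right_eq_self _ c]
  simp only [add_sub_cancel_right]

/-- `cosTail` after the substitution `v = u + c`: `∫_{u ≥ s − c} g(u) K(u + c) du`. [cite: ConnesConsani2021, §2 Prop. 2.2 (iii) (= arXiv Prop. 10 (iii)) p. 10; §1 eq. (16)–(17) p. 7] -/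
theorem cosTail_eq_integral_comp_add (g : ℝ → ℂ) (s c : ℝ) :
    cosTail g s c = ∫ u in Set.Ici (s - c), g u * (cosTailKernel (u + c) : ℂ) := by
  rw [cosTail_eq_integral_indicator, ← integral_indicator measurableSet_Ici,
    ← integral_add_right_eq_self _ c]
  congr 1 with u
  simp only [Set.indicator, Set.mem_Ici, add_sub_cancel_right]
  by_cases h : s - c ≤ u
  · rw [if_pos (by linarith), if_pos h]
  · rw [if_neg (by linarith), if_neg h]

/-! ## Support cut-offs: `cosTail = cosTailFull` below the support, `cosTail = 0` above it -/

/-- If `g(v − c) = 0` for all `v < s`, the cut is invisible: `cosTail g s c = cosTailFull g c`. [cite: ConnesConsani2021, §2 Prop. 2.2 (iii) (= arXiv Prop. 10 (iii)) p. 10; §1 eq. (16)–(17) p. 7] -/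
theorem cosTail_eq_cosTailFull_of_forall_lt (h : ∀ v < s, g (v - c) = 0) :
    cosTail g s c = cosTailFull g c := by
  rw [cosTail_eq_integral_indicator, cosTailFull_eq]
  congr 1 with v
  by_cases hv : v ∈ Set.Ici s
  · rw [Set.indicator_of_mem hv]
  · rw [Set.indicator_of_notMem hv, h v (not_le.1 hv), zero_mul]

/-- If `g(v − c) = 0` for all `v ≥ s`, the tail is empty: `cosTail g s c = 0`. [cite: ConnesConsani2021, §2 Prop. 2.2 (iii) (= arXiv Prop. 10 (iii)) p. 10; §1 eq. (16)–(17) p. 7] -/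
theorem cosTail_eq_zero_of_forall_ge (h : ∀ v, s ≤ v → g (v - c) = 0) : cosTail g s c = 0 := by
  rw [cosTail_eq]
  refine setIntegral_eq_zero_of_forall_eq_zero fun v hv => ?_
  rw [h v hv, zero_mul]

/-- With `supp g ⊆ [−a, a]`: for `s ≤ c − a` the cut is below the support, `cosTail g s c = cosTailFull g c`
(for `v < s` one has `v − c < −a`). [cite: ConnesConsani2021, §1 eq. (17) p. 7] -/
theorem cosTail_eq_cosTailFull (hga : tsupport g ⊆ Set.Icc (-a) a) (hs : s ≤ c - a) :
    cosTail g s c = cosTailFull g c := by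
  refine cosTail_eq_cosTailFull_of_forall_lt fun v hv => ?_
  refine image_eq_zero_of_notMem_tsupport fun hmem => ?_
  have := (hga hmem).1
  linarith

/-- With `supp g ⊆ [−a, a]`: for `c + a < s` the cut is above the support, `cosTail g s c = 0`.
[cite: ConnesConsani2021, §1 eq. (17) p. 7] -/
theorem cosTail_eq_zero (hga : tsupport g ⊆ Set.Icc (-a) a) (hs : c + a < s) : cosTail g s c = 0 := by
  refine cosTail_eq_zero_of_forall_ge fun v hv => ?_
  refine image_eq_zero_of_notMem_tsupport fun hmem => ?_
  have := (hga hmem).2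
  linarith

/-! ## Integrability, bounds, continuity (continuous `g` of compact support) -/

/-- Pointwise bound of the shifted integrand on the support: `‖g(u)K(u + c)‖ ≤ e^{(c+a)/2}‖g(u)‖` when
`supp g ⊆ [−a, a]`. [cite: ConnesConsani2021, §2 Prop. 2.2 (iii) (= arXiv Prop. 10 (iii)) p. 10; §1 eq. (16)–(17) p. 7] -/
theorem norm_mul_cosTailKernel_le (hga : tsupport g ⊆ Set.Icc (-a) a) (c u : ℝ) :
    ‖g u * (cosTailKernel (u + c) : ℂ)‖ ≤ Real.exp ((c + a) / 2) * ‖g u‖ := by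
  rw [norm_mul]
  by_cases hu : u ∈ tsupport g
  · have hua : u ≤ a := (hga hu).2
    calc ‖g u‖ * ‖(cosTailKernel (u + c) : ℂ)‖ ≤ ‖g u‖ * Real.exp ((u + c) / 2) :=
          mul_le_mul_of_nonneg_left (norm_cosTailKernel_le _) (norm_nonneg _)
      _ ≤ ‖g u‖ * Real.exp ((c + a) / 2) :=
          mul_le_mul_of_nonneg_left (Real.exp_le_exp.2 (by linarith)) (norm_nonneg _)
      _ = Real.exp ((c + a) / 2) * ‖g u‖ := mul_comm _ _
  · rw [image_eq_zero_of_notMem_tsupport hu, norm_zero, zero_mul, mul_zero]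

section Continuous

variable (hg : Continuous g) (hgc : HasCompactSupport g)
include hg hgc

/-- The integrand `v ↦ g(v − c) K(v)` is continuous with compact support, hence integrable. [cite: ConnesConsani2021, §2 Prop. 2.2 (iii) (= arXiv Prop. 10 (iii)) p. 10; §1 eq. (16)–(17) p. 7] -/
theorem integrable_cosTail_integrand (c : ℝ) :
    Integrable fun v : ℝ => g (v - c) * (cosTailKernel v : ℂ) := by
  have hc : Continuous fun v : ℝ => g (v - c) * (cosTailKernel v : ℂ) :=
    (hg.comp (continuous_id.sub continuous_const)).mul
      (Complex.continuous_ofReal.comp continuous_cosTailKernel)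
  refine hc.integrable_of_hasCompactSupport ?_
  exact (hgc.comp_homeomorph (Homeomorph.subRight c)).mul_right

/-- The shifted integrand `u ↦ g(u) K(u + c)` is integrable. [cite: ConnesConsani2021, §2 Prop. 2.2 (iii) (= arXiv Prop. 10 (iii)) p. 10; §1 eq. (16)–(17) p. 7] -/
theorem integrable_mul_cosTailKernel (c : ℝ) :
    Integrable fun u : ℝ => g u * (cosTailKernel (u + c) : ℂ) := by
  have hc : Continuous fun u : ℝ => g u * (cosTailKernel (u + c) : ℂ) :=
    hg.mul (Complex.continuous_ofReal.comp
      (continuous_cosTailKernel.comp (continuous_id.add continuous_const)))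
  exact hc.integrable_of_hasCompactSupport hgc.mul_right

/-- The cut integrand is integrable on every `Ici s`. [cite: ConnesConsani2021, §2 Prop. 2.2 (iii) (= arXiv Prop. 10 (iii)) p. 10; §1 eq. (16)–(17) p. 7] -/
theorem integrableOn_cosTail_integrand (s c : ℝ) :
    IntegrableOn (fun v : ℝ => g (v - c) * (cosTailKernel v : ℂ)) (Set.Ici s) :=
  (integrable_cosTail_integrand hg hgc c).integrableOn

/-- `‖cosTail g s c‖ ≤ e^{(c + a)/2} ∫‖g‖` when `supp g ⊆ [−a, a]`. [cite: ConnesConsani2021, §2 Prop. 2.2 (iii) (= arXiv Prop. 10 (iii)) p. 10; §1 eq. (16)–(17) p. 7] -/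
theorem norm_cosTail_le (hga : tsupport g ⊆ Set.Icc (-a) a) (s c : ℝ) :
    ‖cosTail g s c‖ ≤ Real.exp ((c + a) / 2) * ∫ u : ℝ, ‖g u‖ := by
  rw [cosTail_eq_integral_comp_add]
  have hI := integrable_mul_cosTailKernel hg hgc c
  have hi : Integrable fun u : ℝ => Real.exp ((c + a) / 2) * ‖g u‖ :=
    (hg.norm.integrable_of_hasCompactSupport hgc.norm).const_mul _
  calc ‖∫ u in Set.Ici (s - c), g u * (cosTailKernel (u + c) : ℂ)‖
      ≤ ∫ u in Set.Ici (s - c), ‖g u * (cosTailKernel (u + c) : ℂ)‖ :=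
        norm_integral_le_integral_norm _
    _ ≤ ∫ u, ‖g u * (cosTailKernel (u + c) : ℂ)‖ :=
        setIntegral_le_integral hI.norm (Eventually.of_forall fun _ => norm_nonneg _)
    _ ≤ ∫ u, Real.exp ((c + a) / 2) * ‖g u‖ :=
        integral_mono hI.norm hi fun u => norm_mul_cosTailKernel_le hga c u
    _ = Real.exp ((c + a) / 2) * ∫ u, ‖g u‖ := integral_const_mul _ _

/-- `‖cosTailFull g c‖ ≤ e^{(c + a)/2} ∫‖g‖` when `supp g ⊆ [−a, a]`. [cite: ConnesConsani2021, §2 Prop. 2.2 (iii) (= arXiv Prop. 10 (iii)) p. 10; §1 eq. (16)–(17) p. 7] -/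
theorem norm_cosTailFull_le (hga : tsupport g ⊆ Set.Icc (-a) a) (c : ℝ) :
    ‖cosTailFull g c‖ ≤ Real.exp ((c + a) / 2) * ∫ u : ℝ, ‖g u‖ := by
  rw [← cosTail_eq_cosTailFull hga (le_refl (c - a))]
  exact norm_cosTail_le hg hgc hga _ c

/-- `cosTailFull g` is continuous (a parametric integral of a jointly continuous integrand over the
compact set `tsupport g`). [cite: ConnesConsani2021, §2 Prop. 2.2 (iii) (= arXiv Prop. 10 (iii)) p. 10; §1 eq. (16)–(17) p. 7] -/
theorem continuous_cosTailFull : Continuous (cosTailFull g) := by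
  have h : cosTailFull g = fun c => ∫ u in tsupport g, g u * (cosTailKernel (u + c) : ℂ) := by
    funext c
    rw [cosTailFull_eq_integral_comp_add]
    refine (setIntegral_eq_integral_of_forall_compl_eq_zero fun u hu => ?_).symm
    rw [image_eq_zero_of_notMem_tsupport hu, zero_mul]
  rw [h]
  refine continuous_parametric_integral_of_continuous ?_ hgc
  exact (hg.comp continuous_snd).mul (Complex.continuous_ofReal.comp
    (continuous_cosTailKernel.comp (continuous_snd.add continuous_fst)))

/-- `cosTail g` is jointly continuous in `(s, c)` (dominated convergence; for fixed `u ≠ s₀ − c₀` the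
indicator `1_{u ≥ s − c}` is locally constant near `(s₀, c₀)`). [cite: ConnesConsani2021, §2 Prop. 2.2 (iii) (= arXiv Prop. 10 (iii)) p. 10; §1 eq. (16)–(17) p. 7] -/
theorem continuous_cosTail : Continuous (Function.uncurry (cosTail g)) := by
  refine continuous_iff_continuousAt.2 fun p₀ => ?_
  obtain ⟨s₀, c₀⟩ := p₀
  -- rewrite as a parametric integral over `ℝ` of an indicator
  have hrw : Function.uncurry (cosTail g) = fun p : ℝ × ℝ =>
      ∫ u : ℝ, (Set.Ici (p.1 - p.2)).indicator (fun u => g u * (cosTailKernel (u + p.2) : ℂ)) u := by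
    funext p
    show cosTail g p.1 p.2 = _
    rw [cosTail_eq_integral_comp_add, integral_indicator measurableSet_Ici]
  rw [hrw]
  -- dominated convergence at `(s₀, c₀)` with bound `e^{(c₀+1+a)/2}‖g‖` on `|c − c₀| < 1`
  obtain ⟨a, ha⟩ : ∃ a : ℝ, tsupport g ⊆ Set.Icc (-a) a := by
    obtain ⟨r, hr⟩ := hgc.isCompact.isBounded.subset_closedBall 0
    exact ⟨r, fun u hu => by simpa [Real.closedBall_eq_Icc] using hr hu⟩
  refine continuousAt_of_dominated (bound := fun u => Real.exp ((c₀ + 1 + a) / 2) * ‖g u‖) ?_ ?_ ?_ ?_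
  · refine Eventually.of_forall fun p => ?_
    exact ((integrable_mul_cosTailKernel hg hgc p.2).indicator measurableSet_Ici).aestronglyMeasurable
  · have hball : Metric.ball (s₀, c₀) 1 ∈ 𝓝 (s₀, c₀) := Metric.ball_mem_nhds _ one_pos
    filter_upwards [hball] with p hp
    refine Eventually.of_forall fun u => ?_
    have hc : |p.2 - c₀| < 1 := by
      have h1 := Metric.mem_ball.1 hp
      rw [Prod.dist_eq] at h1
      have h2 : dist p.2 c₀ < 1 := (le_max_right _ _).trans_lt h1
      rwa [Real.dist_eq] at h2
    rw [norm_indicator_eq_indicator_norm]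
    refine (Set.indicator_le_self' (fun _ _ => norm_nonneg _) u).trans ?_
    refine (norm_mul_cosTailKernel_le ha p.2 u).trans ?_
    refine mul_le_mul_of_nonneg_right (Real.exp_le_exp.2 ?_) (norm_nonneg _)
    have := (abs_lt.1 hc).2
    linarith
  · exact (hg.norm.integrable_of_hasCompactSupport hgc.norm).const_mul _
  · -- a.e. `u` (namely `u ≠ s₀ − c₀`): continuity at `(s₀, c₀)`
    have hae : ∀ᵐ u : ℝ, u ≠ s₀ - c₀ := by
      simp [ae_iff]
    filter_upwards [hae] with u hu
    have hcont : ContinuousAt (fun p : ℝ × ℝ => g u * (cosTailKernel (u + p.2) : ℂ)) (s₀, c₀) :=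
      (continuousAt_const.mul ((Complex.continuous_ofReal.comp
        (continuous_cosTailKernel.comp (continuous_const.add continuous_snd))).continuousAt))
    rcases lt_or_gt_of_ne hu with hlt | hgt
    · -- `u < s₀ − c₀`: indicator is `0` near `(s₀, c₀)`
      have hev : ∀ᶠ p : ℝ × ℝ in 𝓝 (s₀, c₀), u < p.1 - p.2 :=
        (continuous_fst.sub continuous_snd).continuousAt.eventually (Ioi_mem_nhds hlt)
      refine (continuousAt_const (y := (0 : ℂ))).congr ?_
      filter_upwards [hev] with p hp
      rw [Set.indicator_of_notMem (fun h => (not_le.2 hp) (Set.mem_Ici.1 h))]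
    · -- `u > s₀ − c₀`: indicator is `1` near `(s₀, c₀)`
      have hev : ∀ᶠ p : ℝ × ℝ in 𝓝 (s₀, c₀), p.1 - p.2 < u :=
        (continuous_fst.sub continuous_snd).continuousAt.eventually (Iio_mem_nhds hgt)
      refine hcont.congr ?_
      filter_upwards [hev] with p hp
      rw [Set.indicator_of_mem (Set.mem_Ici.2 hp.le)]

/-- Measurability of `cosTail g` on `ℝ × ℝ` (from joint continuity). [cite: ConnesConsani2021, §2 Prop. 2.2 (iii) (= arXiv Prop. 10 (iii)) p. 10; §1 eq. (16)–(17) p. 7] -/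
theorem measurable_cosTail : Measurable (Function.uncurry (cosTail g)) :=
  (continuous_cosTail hg hgc).measurable

/-- `cosTail g` is a.e. strongly measurable for the product measure restricted to `s ≥ 0` (the form
the Hilbert–Schmidt socket consumes). [cite: ConnesConsani2021, §2 Prop. 2.2 (iii) (= arXiv Prop. 10 (iii)) p. 10; §1 eq. (16)–(17) p. 7] -/
theorem aestronglyMeasurable_cosTail :
    AEStronglyMeasurable (Function.uncurry (cosTail g))
      (((volume : Measure ℝ).restrict (Set.Ici 0)).prod (volume : Measure ℝ)) :=
  (continuous_cosTail hg hgc).aestronglyMeasurable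

end Continuous

end Literature.NumberTheory.ConnesConsani2021

end
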